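import Literature.AnabelianGeometry.SemiGraphs.ArithThm54DesignInputsNonVacuity
import Literature.AnabelianGeometry.SemiGraphs.ArithTotalEstrangementSplitObstruction
import Literature.AnabelianGeometry.SemiGraphs.WitnessIwahoriBundle
import Literature.AnabelianGeometry.SemiGraphs.TemperedPiChartExists
import HarnessLib

/-!
# [SemiAnbd] Thm 5.4 (i) p. 66 — the T54-B capstone's DESIGN inputs at a Thm-3.7 witness WITH AN EDGE
# (the estranged loop `𝒢₁`) and the trivial outer action: all but `hest` jointly inhabited, `hest` refuted

Mochizuki, *Semi-graphs of anabelioids*, Publ. RIMS **42** (2006), §5 Def 5.1 (i) p. 62, Def 5.3 p. 65,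
Thm 5.4 p. 66 [cite: MochizukiSemiAnbd2006, Thm 5.4 (i) p.66]; Prop 3.6 / Thm 3.7 pp. 38–41.

PROOF-ONLY file (cell abc-iut, layer L3, NV column of the T54-B binder board, row «NV-T54-inputs@loopGraph»,
seat abc-iut-w6-d099; no definition, no instance, no new named fact).  Sequel of
`ArithThm54DesignInputsNonVacuity.lean` (same seat: the six design inputs `hV`, `hE`, `hopen`, `noSwitchBase`,
`hest`, `hbot` of abc-iut-w4-d029's capstone `arithMaximalCompactStatementI_outerAction_piPresentation` are
jointly inhabited at the EDGELESS witness `affWitness p`, the edge-indexed ones only vacuously) and of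
abc-iut-w6-d072's `ArithTotalEstrangementSplitObstruction.lean` (`not_isTotallyArithEstranged_of_trivial`: at
the trivial outer action `hest` FAILS as soon as a vertex carries two distinct branches).  Both are consumed
BY NAME at abc-iut-L3-t8's Thm-3.7 witness WITH AN EDGE, the estranged loop `𝒢₁ = IwahoriWitness.loopGraph p`
(`WitnessIwahoriLoop/Approx/Bundle.lean`: one vertex `Π_v = ℤ_p ⋊ (1 + pℤ_p)`, one loop with edge group
`1 + pℤ_p`, `loopGraph_thm37Hypotheses`):

* `capstoneDesignInputs_loopGraph` — for EVERY chart `c` of `𝒢₁`, every topological group `Π_A` whose `{1}`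
  is not open, and the trivial outer action `ρ := 1`, `baseAct := 1`: `Thm37Hypotheses`, `IsGraph`, finite
  vertices and branches, a NONEMPTY edge type, `hV`, `hE`, `hopen`, `noSwitchBase` (now over the loop's two
  branches — the trivial action does not switch them), `hbot`, `Nonempty (ChartRepresentatives c)`, and, for
  EVERY choice of representatives `R` and every topology on `E = π₁^temp(𝒢₁) ⋊^out Π_A`, `¬ hest`;
* `capstoneDesignInputs_loopGraph_padicAffine` — the same with `Π_A := Aff(ℤ_p)` (non-discrete by
  `not_isOpen_singleton_one_padicAffine`) at the canonical chart `temperedPiChart` (so nothing is vacuous).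

NET NV-COLUMN STATEMENT: with an edge present, the capstone's design inputs MINUS `hest` are jointly
satisfiable at a split model, and `hest` is refuted there; hence the full hypothesis set of the capstone is
consistent only at NON-split outer actions — the recorded residual NV obligation («Thm-3.7 witness with an edge
AND a non-split outer action whose arithmetic branch groups meet non-amply»), unchanged and not claimed here.
Nothing here bears on [IUTchIII] Cor. 3.12; typed ≠ proved; a witness certifies consistency only.
-/

noncomputable section

namespace Literature.AnabelianGeometry.SemiGraphs

namespace ProfiniteSemiGraph

open Literature.AnabelianGeometry.EtaleTheta CategoryTheory Topology
open Literature.GroupTheory.SpecificGroups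

variable (p : ℕ) [Fact p.Prime]

/-- The two branches `(0,false) ≠ (0,true)` of the loop of `𝒢₁`, both abutting to its vertex: the shape at
which abc-iut-w6-d072's split obstruction bites. [cite: MochizukiSemiAnbd2006, §1 p.16] -/
theorem loopGraph_two_branches :
    ∃ (b b' : (IwahoriWitness.loopGraph p).graph.Branch) (v : (IwahoriWitness.loopGraph p).graph.Vertex),
      (IwahoriWitness.loopGraph p).graph.abuts b = some v ∧ (IwahoriWitness.loopGraph p).graph.abuts b' = some v ∧ b' ≠ b :=
  ⟨⟨(0, false)⟩, ⟨(0, true)⟩, PUnit.unit, rfl, rfl, fun h =>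
    Bool.noConfusion (congrArg (fun x : ULift.{0} (Fin 1 × Bool) => x.down.2) h)⟩

/-- Compatible representatives exist on every chart of `𝒢₁` (it is a graph of injective type, quasi-coherent
and Galois-countable). [cite: MochizukiSemiAnbd2006, Thm 3.7 (i) p.40] -/
theorem loopGraph_chartRepresentatives_nonempty (c : TemperedPiChart (IwahoriWitness.loopGraph p)) :
    Nonempty (ChartRepresentatives c) :=
  ChartRepresentatives.nonempty c (IwahoriWitness.loopGraph_cor39Hypotheses p).isGraph
    (IwahoriWitness.loopGraph_prop36Hypotheses p).isQuasiCoherent (IwahoriWitness.loopGraph_prop36Hypotheses p).isGaloisCountable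
    (IwahoriWitness.loopGraph_prop36Hypotheses p).isOfInjectiveType

/-- `𝒢₁` has a tempered fundamental group chart (Prop 3.6 (i)(ii) at its Prop-3.6 bundle), so the `∀ c` below
is not vacuous. [cite: MochizukiSemiAnbd2006, Prop 3.6 p.38] -/
theorem loopGraph_temperedPiChart_nonempty : Nonempty (TemperedPiChart (IwahoriWitness.loopGraph p)) :=
  ⟨(IwahoriWitness.loopGraph p).temperedPiChart (IwahoriWitness.loopGraph_prop36Hypotheses p)⟩

/-- **The T54-B design inputs at the estranged loop `𝒢₁` with the trivial outer action: all but `hest`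
jointly inhabited, `hest` refuted** — for every chart `c`, every `Π_A` with `{1}` not open, `ρ := 1`,
`baseAct := 1`.  Conjuncts: `Thm37Hypotheses`; `IsGraph`; finitely many vertices and branches; the edge type is
NONEMPTY; `hV`; `hE`; `hopen`; `noSwitchBase`; `hbot`; representatives exist; and for every `R` and every
topology on `E`, `¬ IsTotallyArithEstranged` (abc-iut-w6-d072's obstruction at the loop's two branches).
[cite: MochizukiSemiAnbd2006, Thm 5.4 (i) p.66] -/
theorem capstoneDesignInputs_loopGraph (c : TemperedPiChart (IwahoriWitness.loopGraph p))
    (PA : Type) [Group PA] [TopologicalSpace PA] (hPA : ¬ IsOpen ({1} : Set PA)) :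
    (IwahoriWitness.loopGraph p).Thm37Hypotheses ∧ (IwahoriWitness.loopGraph p).graph.IsGraph ∧
    Finite (IwahoriWitness.loopGraph p).graph.Vertex ∧ Finite (IwahoriWitness.loopGraph p).graph.Branch ∧
    Nonempty (IwahoriWitness.loopGraph p).graph.Edge ∧
    -- hV
    (∀ (a : PA) (v : (IwahoriWitness.loopGraph p).graph.Vertex) (H : Subgroup c.G), H ∈ verticialSubgroups c v →
      ∃ φ : contMulAut c.G, TopOut.mk c.G φ = (1 : PA →* TopOut c.G) a ∧
        H.map (φ : MulAut c.G).toMonoidHom ∈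
          verticialSubgroups c (((1 : PA →* Aut (IwahoriWitness.loopGraph p).graph) a).hom.vertexMap v)) ∧
    -- hE
    (∀ (a : PA) (e : (IwahoriWitness.loopGraph p).graph.Edge) (K : Subgroup c.G), K ∈ edgeLikeSubgroups c e →
      ∃ φ : contMulAut c.G, TopOut.mk c.G φ = (1 : PA →* TopOut c.G) a ∧
        K.map (φ : MulAut c.G).toMonoidHom ∈
          edgeLikeSubgroups c (((1 : PA →* Aut (IwahoriWitness.loopGraph p).graph) a).hom.edgeMap e)) ∧
    -- hopen
    (∃ U : Subgroup PA, IsOpen (U : Set PA) ∧ ∀ a ∈ U,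
      (∀ v, ((1 : PA →* Aut (IwahoriWitness.loopGraph p).graph) a).hom.vertexMap v = v) ∧
      (∀ e, ((1 : PA →* Aut (IwahoriWitness.loopGraph p).graph) a).hom.edgeMap e = e) ∧
        ∀ b, ((1 : PA →* Aut (IwahoriWitness.loopGraph p).graph) a).hom.branchMap b = b) ∧
    -- noSwitchBase
    NoBranchSwitching (IwahoriWitness.loopGraph p).graph.edgeOf
      (fun (a : PA) (b : (IwahoriWitness.loopGraph p).graph.Branch) =>
        ((1 : PA →* Aut (IwahoriWitness.loopGraph p).graph) a).hom.branchMap b) ∧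
    -- hbot
    ¬ IsArithAmple (outerSemidirectProductSnd (1 : PA →* TopOut c.G))
        (⊥ : Subgroup (outerSemidirectProduct (1 : PA →* TopOut c.G))) ∧
    -- representatives exist, and hest FAILS for every choice of them
    Nonempty (ChartRepresentatives c) ∧
    (∀ [TopologicalSpace (outerSemidirectProduct (1 : PA →* TopOut c.G))] (R : ChartRepresentatives c),
      ¬ IsTotallyArithEstranged
          (decompositionDataOfChart R (toOuterSemidirectProduct (1 : PA →* TopOut c.G)))
          (outerSemidirectProductSnd (1 : PA →* TopOut c.G))) := by
  obtain ⟨b, b', v, hb, hb', hne⟩ := loopGraph_two_branches p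
  refine ⟨IwahoriWitness.loopGraph_thm37Hypotheses p, (IwahoriWitness.loopGraph_cor39Hypotheses p).isGraph, ?_, ?_, ⟨⟨0⟩⟩,
    hV_of_trivialOuterAction c PA, hE_of_trivialOuterAction c PA,
    hopen_of_trivialBaseAct (𝒢 := IwahoriWitness.loopGraph p) PA,
    noBranchSwitching_of_trivialBaseAct (𝒢 := IwahoriWitness.loopGraph p) PA,
    not_isArithAmple_bot_of_not_isOpen_singleton_one PA hPA _,
    loopGraph_chartRepresentatives_nonempty p c, ?_⟩
  · exact (show Finite PUnit.{1} from inferInstance)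
  · exact (show Finite (ULift.{0} (Fin 1 × Bool)) from inferInstance)
  · intro _ R
    exact not_isTotallyArithEstranged_of_trivial c R hb hb' hne

/-- **The same at `Π_A := Aff(ℤ_p)` and the canonical chart `temperedPiChart`** (nothing vacuous: the chart,
the representatives, the edge and the non-discreteness of `Π_A` are all supplied): design inputs minus `hest`
jointly inhabited, `hest` refuted. [cite: MochizukiSemiAnbd2006, Thm 5.4 (i) p.66] -/
theorem capstoneDesignInputs_loopGraph_padicAffine :
    let c := (IwahoriWitness.loopGraph p).temperedPiChart (IwahoriWitness.loopGraph_prop36Hypotheses p)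
    (IwahoriWitness.loopGraph p).Thm37Hypotheses ∧ (IwahoriWitness.loopGraph p).graph.IsGraph ∧
    Finite (IwahoriWitness.loopGraph p).graph.Vertex ∧ Finite (IwahoriWitness.loopGraph p).graph.Branch ∧
    Nonempty (IwahoriWitness.loopGraph p).graph.Edge ∧
    (∀ (a : PadicAffine p) (v : (IwahoriWitness.loopGraph p).graph.Vertex) (H : Subgroup c.G),
      H ∈ verticialSubgroups c v →
        ∃ φ : contMulAut c.G, TopOut.mk c.G φ = (1 : PadicAffine p →* TopOut c.G) a ∧
          H.map (φ : MulAut c.G).toMonoidHom ∈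
            verticialSubgroups c (((1 : PadicAffine p →* Aut (IwahoriWitness.loopGraph p).graph) a).hom.vertexMap v)) ∧
    (∀ (a : PadicAffine p) (e : (IwahoriWitness.loopGraph p).graph.Edge) (K : Subgroup c.G), K ∈ edgeLikeSubgroups c e →
      ∃ φ : contMulAut c.G, TopOut.mk c.G φ = (1 : PadicAffine p →* TopOut c.G) a ∧
        K.map (φ : MulAut c.G).toMonoidHom ∈
          edgeLikeSubgroups c (((1 : PadicAffine p →* Aut (IwahoriWitness.loopGraph p).graph) a).hom.edgeMap e)) ∧
    (∃ U : Subgroup (PadicAffine p), IsOpen (U : Set (PadicAffine p)) ∧ ∀ a ∈ U,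
      (∀ v, ((1 : PadicAffine p →* Aut (IwahoriWitness.loopGraph p).graph) a).hom.vertexMap v = v) ∧
      (∀ e, ((1 : PadicAffine p →* Aut (IwahoriWitness.loopGraph p).graph) a).hom.edgeMap e = e) ∧
        ∀ b, ((1 : PadicAffine p →* Aut (IwahoriWitness.loopGraph p).graph) a).hom.branchMap b = b) ∧
    NoBranchSwitching (IwahoriWitness.loopGraph p).graph.edgeOf
      (fun (a : PadicAffine p) (b : (IwahoriWitness.loopGraph p).graph.Branch) =>
        ((1 : PadicAffine p →* Aut (IwahoriWitness.loopGraph p).graph) a).hom.branchMap b) ∧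
    ¬ IsArithAmple (outerSemidirectProductSnd (1 : PadicAffine p →* TopOut c.G))
        (⊥ : Subgroup (outerSemidirectProduct (1 : PadicAffine p →* TopOut c.G))) ∧
    Nonempty (ChartRepresentatives c) ∧
    (∀ [TopologicalSpace (outerSemidirectProduct (1 : PadicAffine p →* TopOut c.G))]
      (R : ChartRepresentatives c),
      ¬ IsTotallyArithEstranged
          (decompositionDataOfChart R (toOuterSemidirectProduct (1 : PadicAffine p →* TopOut c.G)))
          (outerSemidirectProductSnd (1 : PadicAffine p →* TopOut c.G))) :=
  capstoneDesignInputs_loopGraph p _ (PadicAffine p) (not_isOpen_singleton_one_padicAffine p)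

end ProfiniteSemiGraph

end Literature.AnabelianGeometry.SemiGraphs

end
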